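import Literature.NumberTheory.Transcendental.CurvePeriodsPathApproxProofs
import Mathlib.AlgebraicTopology.FundamentalGroupoid.FundamentalGroup
import Mathlib.GroupTheory.Commutator.Basic
import HarnessLib

/-!
# Periods of curve type: the symbol descends to the fundamental groupoid, and to `H₁ = π₁ᵃᵇ`

Companion of `Literature/NumberTheory/Transcendental/CurvePeriods.lean` (Huber–Wüstholz 2022,
Thm. 13.3 (2), rendered on explicit period symbols `(Z, ω, γ)`; the general statement is the
named fact `HuberWustholzCurvePeriods`). For an embedded smooth affine curve `Z` over `ℚ̄` and
algebraic points `x, y, … ∈ Z(ℚ̄)`, every homotopy class `c ∈ Π₁(Z(ℂ))(x, y)`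
(`Path.Homotopic.Quotient x y`) has a `C¹` representative `classRep c : CurvePath Z`
(`exists_curvePath_of_class`, from `exists_curvePath_of_path`), and modulo the `ℚ̄`-span of
the elementary relations (R1)–(R5) its symbol `(Z, ω, classRep c)`:

* agrees with `(Z, ω, γ)` for every `C¹` path `γ` in the class (`span_classRep_mk_sub_single`);
* is additive along composition in the fundamental groupoid (`span_classRep_trans`), vanishes on
  identities (`span_classRep_refl`) and is odd under inversion (`span_classRep_symm`);
* hence, on the fundamental group `π₁(Z(ℂ), x)` (`FundamentalGroup`), is a homomorphism to an
  abelian group (`span_classRep_mul`, `span_classRep_one`, `span_classRep_inv`) which kills the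
  commutator subgroup (`span_classRep_of_mem_commutator`): **the symbol of a loop only depends on
  its class in `π₁ᵃᵇ = H₁(Z(ℂ); ℤ)`**, and in particular (`period_eq_zero_of_mem_commutator`)
  `∫_γ ω = 0` for every `C¹` loop `γ` whose class lies in the commutator subgroup;
* free loops: every closed path `ℓ` at an arbitrary point of `Z(ℂ)`, connected to an algebraic
  point by a continuous path `d`, has the `C¹` representative of `d ⋆ ℓ ⋆ d⁻¹`
  (`exists_curvePath_of_freeLoop`), whose symbol does not depend on `d` or on the base point
  (`span_single_sub_single_of_freeLoop`; book §3.3.1: "a closed path").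

This is the path side of the comparison between the elementary rendering and the book's
`H₁^sing(Z^an, D; ℚ)` (§3.3.1), in the strongest form available without a singular homology
library (Hurewicz `π₁ᵃᵇ ≅ H₁` being the missing identification).

## References

* A. Huber, G. Wüstholz, *Transcendence and Linear Relations of 1-Periods*, Cambridge Tracts in
  Mathematics 227, CUP 2022 [HuberWustholz2022]: §3.3.1 (pp. 42–44 of the held text), Thm. 13.3 (2)
  (p. 121).
-/

noncomputable section

open scoped BigOperators Topology unitInterval commutatorElement
open MvPolynomial Set Filter

namespace Literature.NumberTheory.Transcendental

namespace CurvePeriods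

set_option quotPrecheck false in
/-- Membership in the `ℚ̄`-span of the elementary relations, in the format of the conclusion of
`HuberWustholzCurvePeriods`. -/
local notation "InSpan" c:max => ∃ (k : ℕ) (ρ : Fin k → (PeriodSymbol →₀ ℂ)) (a : Fin k → ℂ),
  (∀ l, IsElementaryRelation (ρ l)) ∧ (∀ l, IsAlgebraic ℚ (a l)) ∧ c = ∑ l, a l • ρ l

variable {Z : CurveData}

/-! ### `C¹` representatives of homotopy classes -/

/-- **Every homotopy class of paths between algebraic points of `Z(ℂ)` has a `C¹`
representative.** [cite: HuberWustholz2022, §3.3.1 (pp. 42–44)] -/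
theorem exists_curvePath_of_class (hZ : Z.IsSmoothAffineCurve) {x y : Z.points}
    (hx : ∀ i, IsAlgebraic ℚ ((x : Fin Z.n → ℂ) i)) (hy : ∀ i, IsAlgebraic ℚ ((y : Fin Z.n → ℂ) i))
    (c : Path.Homotopic.Quotient x y) :
    ∃ (γ : CurvePath Z) (q : Path x y), (∀ t : I, γ.toFun t = q t) ∧
      Path.Homotopic.Quotient.mk q = c := by
  induction c using Path.Homotopic.Quotient.ind with | mk p => ?_
  obtain ⟨γ, q, hγ, hpq⟩ := exists_curvePath_of_path hZ p hx hy
  exact ⟨γ, q, hγ, Path.Homotopic.Quotient.eq.mpr hpq.symm⟩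

/-- A chosen `C¹` representative of a homotopy class of paths between algebraic points.
[folklore] -/
def classRep (hZ : Z.IsSmoothAffineCurve) {x y : Z.points}
    (hx : ∀ i, IsAlgebraic ℚ ((x : Fin Z.n → ℂ) i)) (hy : ∀ i, IsAlgebraic ℚ ((y : Fin Z.n → ℂ) i))
    (c : Path.Homotopic.Quotient x y) : CurvePath Z :=
  (exists_curvePath_of_class hZ hx hy c).choose

/-- The chosen representative lies in the class. [folklore] -/
theorem classRep_spec (hZ : Z.IsSmoothAffineCurve) {x y : Z.points}
    (hx : ∀ i, IsAlgebraic ℚ ((x : Fin Z.n → ℂ) i)) (hy : ∀ i, IsAlgebraic ℚ ((y : Fin Z.n → ℂ) i))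
    (c : Path.Homotopic.Quotient x y) :
    ∃ q : Path x y, (∀ t : I, (classRep hZ hx hy c).toFun t = q t) ∧
      Path.Homotopic.Quotient.mk q = c :=
  (exists_curvePath_of_class hZ hx hy c).choose_spec

section Groupoid

variable (hZ : Z.IsSmoothAffineCurve) (ω : Fin Z.n → MvPolynomial (Fin Z.n) ℂ)
  (h : ∀ i, HasAlgCoeffs (ω i)) {x y z : Z.points}
  (hx : ∀ i, IsAlgebraic ℚ ((x : Fin Z.n → ℂ) i)) (hy : ∀ i, IsAlgebraic ℚ ((y : Fin Z.n → ℂ) i))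
  (hz : ∀ i, IsAlgebraic ℚ ((z : Fin Z.n → ℂ) i))

/-- **The symbol of the class is the symbol of any `C¹` path in it**: for a `C¹` path `γ`
agreeing with `p : Path x y`, `(Z, ω, classRep [p]) − (Z, ω, γ)` lies in the span of the
elementary relations. [cite: HuberWustholz2022, §3.3.1 (pp. 42–44)] -/
theorem span_classRep_mk_sub_single (γ : CurvePath Z) (p : Path x y)
    (hγ : ∀ t : I, γ.toFun t = p t) :
    InSpan (Finsupp.single (⟨Z, hZ, ω, h, classRep hZ hx hy (Path.Homotopic.Quotient.mk p)⟩ :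
        PeriodSymbol) (1 : ℂ) - Finsupp.single ⟨Z, hZ, ω, h, γ⟩ 1) := by
  obtain ⟨q, hq, hqc⟩ := classRep_spec hZ hx hy (Path.Homotopic.Quotient.mk p)
  exact span_single_sub_single_of_homotopic hZ ω h q p (Path.Homotopic.Quotient.eq.mp hqc) _ γ hq hγ

/-- **Additivity along composition in the fundamental groupoid**:
`(Z, ω, classRep (a ≫ b)) − (Z, ω, classRep a) − (Z, ω, classRep b)` lies in the span of the
elementary relations. [cite: HuberWustholz2022, §3.3.1 (pp. 42–44)] -/
theorem span_classRep_trans (a : Path.Homotopic.Quotient x y) (b : Path.Homotopic.Quotient y z) :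
    InSpan (Finsupp.single (⟨Z, hZ, ω, h, classRep hZ hx hz (a.trans b)⟩ : PeriodSymbol) (1 : ℂ) -
        Finsupp.single ⟨Z, hZ, ω, h, classRep hZ hx hy a⟩ 1 -
        Finsupp.single ⟨Z, hZ, ω, h, classRep hZ hy hz b⟩ 1) := by
  induction a using Path.Homotopic.Quotient.ind with | mk p => ?_
  induction b using Path.Homotopic.Quotient.ind with | mk p' => ?_
  obtain ⟨q, hq, hqc⟩ := classRep_spec hZ hx hz
    ((Path.Homotopic.Quotient.mk p).trans (Path.Homotopic.Quotient.mk p'))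
  obtain ⟨qa, hqa, hqac⟩ := classRep_spec hZ hx hy (Path.Homotopic.Quotient.mk p)
  obtain ⟨qb, hqb, hqbc⟩ := classRep_spec hZ hy hz (Path.Homotopic.Quotient.mk p')
  rw [← Path.Homotopic.Quotient.mk_trans] at hqc
  have hhom : q.Homotopic (qa.trans qb) :=
    (Path.Homotopic.Quotient.eq.mp hqc).trans
      ((Path.Homotopic.Quotient.eq.mp hqac).symm.hcomp (Path.Homotopic.Quotient.eq.mp hqbc).symm)
  exact span_of_homotopic_trans hZ ω h q qa qb hhom _ _ _ hq hqa hqb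

/-- **Identities have symbol `∼ 0`**: `(Z, ω, classRep (𝟙 x))` lies in the span of the
elementary relations. [cite: HuberWustholz2022, §3.3.1 (pp. 42–44)] -/
theorem span_classRep_refl :
    InSpan (Finsupp.single (⟨Z, hZ, ω, h, classRep hZ hx hx (Path.Homotopic.Quotient.refl x)⟩ :
        PeriodSymbol) (1 : ℂ)) := by
  obtain ⟨q, hq, hqc⟩ := classRep_spec hZ hx hx (Path.Homotopic.Quotient.refl x)
  rw [← Path.Homotopic.Quotient.mk_refl] at hqc
  exact span_single_of_nullhomotopic hZ ω h q (Path.Homotopic.Quotient.eq.mp hqc) _ hq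

/-- **Inverses have opposite symbols**: `(Z, ω, classRep a⁻¹) + (Z, ω, classRep a)` lies in the
span of the elementary relations. [cite: HuberWustholz2022, §3.3.1 (pp. 42–44)] -/
theorem span_classRep_symm (a : Path.Homotopic.Quotient x y) :
    InSpan (Finsupp.single (⟨Z, hZ, ω, h, classRep hZ hy hx a.symm⟩ : PeriodSymbol) (1 : ℂ) +
        Finsupp.single ⟨Z, hZ, ω, h, classRep hZ hx hy a⟩ 1) := by
  induction a using Path.Homotopic.Quotient.ind with | mk p => ?_
  obtain ⟨qa, hqa, hqac⟩ := classRep_spec hZ hx hy (Path.Homotopic.Quotient.mk p)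
  obtain ⟨q', hq', hq'c⟩ := classRep_spec hZ hy hx (Path.Homotopic.Quotient.mk p).symm
  rw [← Path.Homotopic.Quotient.mk_symm] at hq'c
  have hhom : q'.Homotopic qa.symm :=
    (Path.Homotopic.Quotient.eq.mp hq'c).trans (Path.Homotopic.Quotient.eq.mp hqac).symm.symm₂
  have h1 := span_single_sub_single_of_homotopic hZ ω h q' qa.symm hhom _
    (classRep hZ hx hy (Path.Homotopic.Quotient.mk p)).reverse hq'
    (CurvePath.reverse_eq_symm qa _ hqa)
  have h2 := span_single_add_single_reverse hZ ω h (classRep hZ hx hy (Path.Homotopic.Quotient.mk p))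
  obtain ⟨k, ρ, c, hρ, hc, he⟩ := span_add h1 h2
  exact ⟨k, ρ, c, hρ, hc, by rw [← he]; abel⟩

end Groupoid

/-! ### The fundamental group and its commutator subgroup -/

section Group

variable (hZ : Z.IsSmoothAffineCurve) (ω : Fin Z.n → MvPolynomial (Fin Z.n) ℂ)
  (h : ∀ i, HasAlgCoeffs (ω i)) {x : Z.points} (hx : ∀ i, IsAlgebraic ℚ ((x : Fin Z.n → ℂ) i))

/-- **Multiplicativity on `π₁(Z(ℂ), x)`** (an algebraic base point):
`(Z, ω, classRep (a * b)) − (Z, ω, classRep a) − (Z, ω, classRep b)` lies in the span of the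
elementary relations. [cite: HuberWustholz2022, §3.3.1 (pp. 42–44)] -/
theorem span_classRep_mul (a b : FundamentalGroup Z.points x) :
    InSpan (Finsupp.single (⟨Z, hZ, ω, h, classRep hZ hx hx (a * b)⟩ : PeriodSymbol) (1 : ℂ) -
        Finsupp.single ⟨Z, hZ, ω, h, classRep hZ hx hx a⟩ 1 -
        Finsupp.single ⟨Z, hZ, ω, h, classRep hZ hx hx b⟩ 1) := by
  rw [FundamentalGroup.mul_def]
  obtain ⟨k, ρ, c, hρ, hc, he⟩ := span_classRep_trans hZ ω h hx hx hx b a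
  exact ⟨k, ρ, c, hρ, hc, by rw [← he]; abel⟩

/-- **The unit of `π₁` has symbol `∼ 0`.** [cite: HuberWustholz2022, §3.3.1 (pp. 42–44)] -/
theorem span_classRep_one :
    InSpan (Finsupp.single (⟨Z, hZ, ω, h, classRep hZ hx hx (1 : FundamentalGroup Z.points x)⟩ :
        PeriodSymbol) (1 : ℂ)) := by
  rw [FundamentalGroup.one_def]
  exact span_classRep_refl hZ ω h hx

/-- **Inversion in `π₁` negates the symbol.** [cite: HuberWustholz2022, §3.3.1 (pp. 42–44)] -/
theorem span_classRep_inv (a : FundamentalGroup Z.points x) :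
    InSpan (Finsupp.single (⟨Z, hZ, ω, h, classRep hZ hx hx (a⁻¹ : FundamentalGroup Z.points x)⟩ :
        PeriodSymbol) (1 : ℂ) + Finsupp.single ⟨Z, hZ, ω, h, classRep hZ hx hx a⟩ 1) := by
  rw [FundamentalGroup.inv_def]
  exact span_classRep_symm hZ ω h hx hx a

/-- **The symbol kills the commutator subgroup of `π₁(Z(ℂ), x)`**: for `g` in the commutator
subgroup, `(Z, ω, classRep g)` lies in the span of the elementary relations — the symbol of a
loop only depends on its class in `π₁ᵃᵇ = H₁(Z(ℂ); ℤ)`. (The set of `g` with this property is a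
subgroup, by the three previous results, and contains all commutators.)
[cite: HuberWustholz2022, §3.3.1 (pp. 42–44)] -/
theorem span_classRep_of_mem_commutator (g : FundamentalGroup Z.points x)
    (hg : g ∈ commutator (FundamentalGroup Z.points x)) :
    InSpan (Finsupp.single (⟨Z, hZ, ω, h, classRep hZ hx hx g⟩ : PeriodSymbol) (1 : ℂ)) := by
  -- the subgroup of classes with symbol `∼ 0`
  let S : Subgroup (FundamentalGroup Z.points x) :=
    { carrier := {g | InSpan (Finsupp.single (⟨Z, hZ, ω, h, classRep hZ hx hx g⟩ : PeriodSymbol)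
        (1 : ℂ))}
      mul_mem' := fun {a b} ha hb => by
        obtain ⟨k, ρ, c, hρ, hc, he⟩ := span_add (span_classRep_mul hZ ω h hx a b) (span_add ha hb)
        exact ⟨k, ρ, c, hρ, hc, by rw [← he]; abel⟩
      one_mem' := span_classRep_one hZ ω h hx
      inv_mem' := fun {a} ha => by
        obtain ⟨k, ρ, c, hρ, hc, he⟩ := span_sub (span_classRep_inv hZ ω h hx a) ha
        exact ⟨k, ρ, c, hρ, hc, by rw [← he]; abel⟩ }
  -- it contains the commutators
  have hcomm : commutatorSet (FundamentalGroup Z.points x) ⊆ S := by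
    rintro g ⟨a, b, rfl⟩
    show InSpan (Finsupp.single (⟨Z, hZ, ω, h,
      classRep hZ hx hx (⁅a, b⁆ : FundamentalGroup Z.points x)⟩ : PeriodSymbol) (1 : ℂ))
    rw [commutatorElement_def]
    have h1 := span_classRep_mul hZ ω h hx (a * b * a⁻¹) b⁻¹
    have h2 := span_classRep_mul hZ ω h hx (a * b) a⁻¹
    have h3 := span_classRep_mul hZ ω h hx a b
    have h4 := span_classRep_inv hZ ω h hx a
    have h5 := span_classRep_inv hZ ω h hx b
    obtain ⟨k, ρ, c, hρ, hc, he⟩ :=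
      span_add (span_add (span_add h1 h2) (span_add h3 h4)) h5
    exact ⟨k, ρ, c, hρ, hc, by rw [← he]; abel⟩
  have hle : commutator (FundamentalGroup Z.points x) ≤ S := by
    rw [commutator_eq_closure]
    exact (Subgroup.closure_le S).mpr hcomm
  exact hle hg

/-- **A `C¹` loop whose class lies in the commutator subgroup has symbol `∼ 0`.**
[cite: HuberWustholz2022, §3.3.1 (pp. 42–44)] -/
theorem span_single_of_mem_commutator (γ : CurvePath Z) (p : Path x x)
    (hγ : ∀ t : I, γ.toFun t = p t)
    (hp : (FundamentalGroup.fromPath (Path.Homotopic.Quotient.mk p)) ∈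
      commutator (FundamentalGroup Z.points x)) :
    InSpan (Finsupp.single (⟨Z, hZ, ω, h, γ⟩ : PeriodSymbol) (1 : ℂ)) := by
  have hx' : ∀ i, IsAlgebraic ℚ ((x : Fin Z.n → ℂ) i) := fun i => by
    rw [← toFun_zero_of_eq_path hγ]; exact γ.algebraic_zero i
  have h1 := span_classRep_of_mem_commutator hZ ω h hx' _ hp
  have h2 := span_classRep_mk_sub_single hZ ω h hx' hx' γ p hγ
  obtain ⟨k, ρ, c, hρ, hc, he⟩ := span_sub h1 h2
  exact ⟨k, ρ, c, hρ, hc, by rw [← he]; abel⟩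

/-- **Periods vanish on the commutator subgroup**: `∫_γ ω = 0` for every `C¹` loop `γ` on `Z`
(algebraic base point) whose homotopy class lies in the commutator subgroup of `π₁(Z(ℂ), x)` and
every polynomial `1`-form `ω` over `ℚ̄` — the period pairing factors through
`π₁ᵃᵇ = H₁(Z(ℂ); ℤ)`. [cite: HuberWustholz2022, §3.3.1 (pp. 42–44), Cor. 12.7 (p. 116)] -/
theorem period_eq_zero_of_mem_commutator (γ : CurvePath Z) (p : Path x x)
    (hγ : ∀ t : I, γ.toFun t = p t)
    (hp : (FundamentalGroup.fromPath (Path.Homotopic.Quotient.mk p)) ∈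
      commutator (FundamentalGroup Z.points x)) :
    (⟨Z, hZ, ω, h, γ⟩ : PeriodSymbol).period = 0 := by
  obtain ⟨k, ρ, c, hρ, _, he⟩ := span_single_of_mem_commutator hZ ω h γ p hγ hp
  have h0 := evalCombination_eq_zero_of_isElementaryRelation ρ c hρ
  rw [← he, evalCombination_single, one_mul] at h0
  exact h0

end Group

/-! ### Free loops: every closed path has a symbol -/

section FreeLoops

open CategoryTheory

/-- Change of the connecting path for a free loop: `d ⋆ ℓ ⋆ d⁻¹` and
`e ⋆ (d′ ⋆ ℓ ⋆ d′⁻¹) ⋆ e⁻¹`, `e = d ⋆ d′⁻¹`, are homotopic with fixed end points (a groupoid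
identity in the fundamental groupoid). [folklore] -/
theorem homotopic_conj_change_path {X : Type*} [TopologicalSpace X] {x x' z : X} (d : Path x z)
    (d' : Path x' z) (ℓ : Path z z) :
    (d.trans (ℓ.trans d.symm)).Homotopic
      ((d.trans d'.symm).trans ((d'.trans (ℓ.trans d'.symm)).trans (d.trans d'.symm).symm)) := by
  apply Path.Homotopic.Quotient.eq.mp
  let D : FundamentalGroupoid.mk x ⟶ FundamentalGroupoid.mk z := Path.Homotopic.Quotient.mk d
  let D' : FundamentalGroupoid.mk x' ⟶ FundamentalGroupoid.mk z := Path.Homotopic.Quotient.mk d'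
  let L : FundamentalGroupoid.mk z ⟶ FundamentalGroupoid.mk z := Path.Homotopic.Quotient.mk ℓ
  change D ≫ L ≫ Groupoid.inv D =
    (D ≫ Groupoid.inv D') ≫ (D' ≫ L ≫ Groupoid.inv D') ≫ Groupoid.inv (D ≫ Groupoid.inv D')
  simp

/-- **Every closed path has a `C¹` representative based at an algebraic point**: for a loop
`ℓ : Path z z` at an arbitrary point `z ∈ Z(ℂ)` and a continuous path `d` from an algebraic
point `x` to `z`, the loop `d ⋆ ℓ ⋆ d⁻¹` is homotopic to a `C¹` loop with algebraic base point
(book §3.3.1: "a closed path"; here via `exists_curvePath_of_path`).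
[cite: HuberWustholz2022, §3.3.1 (pp. 42–44)] -/
theorem exists_curvePath_of_freeLoop (hZ : Z.IsSmoothAffineCurve) {z x : Z.points} (ℓ : Path z z)
    (d : Path x z) (hx : ∀ i, IsAlgebraic ℚ ((x : Fin Z.n → ℂ) i)) :
    ∃ (γ : CurvePath Z) (q : Path x x), (∀ t : I, γ.toFun t = q t) ∧
      q.Homotopic (d.trans (ℓ.trans d.symm)) := by
  obtain ⟨γ, q, hγ, hq⟩ := exists_curvePath_of_path hZ (d.trans (ℓ.trans d.symm)) hx hx
  exact ⟨γ, q, hγ, hq.symm⟩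

/-- **The symbol of a free loop is well defined**: if `γ` (based at `x`) and `γ′` (based at
`x′`) are `C¹` loops with algebraic base points representing `d ⋆ ℓ ⋆ d⁻¹` and `d′ ⋆ ℓ ⋆ d′⁻¹`
for the same loop `ℓ` at `z` and arbitrary continuous connecting paths `d : x ⇝ z`,
`d′ : x′ ⇝ z`, then `(Z, ω, γ) − (Z, ω, γ′)` lies in the span of the elementary relations
(`span_single_sub_single_of_freelyHomotopic` along `d ⋆ d′⁻¹`). Hence every free homotopy class
of closed paths in (a path component containing an algebraic point of) `Z(ℂ)` has a symbol
modulo (R1)–(R5). [cite: HuberWustholz2022, §3.3.1 (pp. 42–44)] -/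
theorem span_single_sub_single_of_freeLoop (hZ : Z.IsSmoothAffineCurve)
    (ω : Fin Z.n → MvPolynomial (Fin Z.n) ℂ) (h : ∀ i, HasAlgCoeffs (ω i)) {z x x' : Z.points}
    (ℓ : Path z z) (d : Path x z)
    (d' : Path x' z) (γ γ' : CurvePath Z) (q : Path x x) (q' : Path x' x')
    (hγ : ∀ t : I, γ.toFun t = q t) (hγ' : ∀ t : I, γ'.toFun t = q' t)
    (hq : q.Homotopic (d.trans (ℓ.trans d.symm))) (hq' : q'.Homotopic (d'.trans (ℓ.trans d'.symm))) :
    InSpan (Finsupp.single (⟨Z, hZ, ω, h, γ⟩ : PeriodSymbol) (1 : ℂ) -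
        Finsupp.single ⟨Z, hZ, ω, h, γ'⟩ 1) := by
  have he : q.Homotopic ((d.trans d'.symm).trans (q'.trans (d.trans d'.symm).symm)) :=
    (hq.trans (homotopic_conj_change_path d d' ℓ)).trans
      ((Path.Homotopic.refl _).hcomp (hq'.symm.hcomp (Path.Homotopic.refl _)))
  exact span_single_sub_single_of_freelyHomotopic hZ ω h q q' (d.trans d'.symm) he γ γ' hγ hγ'

end FreeLoops

end CurvePeriods

end Literature.NumberTheory.Transcendental

end
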